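import Summits.AnomalousDissipation.AnomalousDissipation.Theorems.TaylorCertificatePair.Negative.Ceiling
import Literature.Analysis.FluidPDE.StatisticalSolutionEnergyEq
import Literature.Analysis.FluidPDE.StatisticalSolutionProofs
import Literature.Analysis.FluidPDE.SteadyNavierStokesEnergy
import Literature.Analysis.FluidPDE.SteadyNavierStokesProofs
import Literature.Analysis.FunctionSpaces.TorusFluidGlueProofs
import Literature.Analysis.FunctionSpaces.TorusCalculusProofs
import Literature.Analysis.FunctionSpaces.TorusFourierCalculus

/-!
# `TaylorCertificates.FloorCertificate` (stmt-AnomalousDissipation-14091) — negative side I: weak duality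

Crux `FloorCertificate` (route `AnomalousDissipation/TaylorCertificates`, rank 5): ONE smooth solenoidal
mean-zero force `f` and `ε₀, ν₀ > 0` such that for every `ν ∈ (0, ν₀)` some cylindrical test functional
`Φ₁` and weight `θ₁ ≤ 0` satisfy the FLOOR inequality
`ε₀ ≤ ν‖∇u‖² + ⟨F(u), Φ₁'(u)⟩ + 2θ₁((u,f) − ν‖∇u‖²)` at every finite-enstrophy state of the Leray ball.

This support file (cdisprove seat `refuter-cdisprove-stmt-AnomalousDissipation-14091-0`, 2026-08-16)
records the kernel-checked NECESSARY CONDITIONS of the crux — what any proof must deliver and what any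
refutation must produce:

* `floorCertificate_iff` — the crux unbundled into `FloorFamily f ε₀ ν` (definitional).
* `floor_at_rest`, `floorFamily_force_ne_zero` — the multiplier pushes against `f` at rest
  (`ε₀ ≤ (f, Φ₁'(0))`); `f = 0` is never a witness.
* `floorFamily_le_ensembleDissipation` — WEAK DUALITY: a floor family for `(f, ε₀, ν)` forces EVERY
  stationary statistical solution of `NS_ν(f)` (FMRT IV Def. 1.3) to have mean dissipation `≥ ε₀`;
  `floorFamily_le_dissipation_of_steady` — every steady weak solution `u ∈ V` has `ν‖∇u‖² ≥ ε₀`;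
  `floorCertificate_steady_states_loud` — under the crux, Leray's steady states (which exist at every `ν`)
  are uniformly loud. Negative lemmas `floorCertificate_false_of_quietStatistics`,
  `floorCertificate_false_of_quietSteadyStates`: quiet stationary statistics / a quiet steady branch FOR
  EVERY FORCE would kill the crux (both hypotheses are OPEN — the route header's inverse-design question).
* `floor_at_quiet_euler_point` — COERCIVITY DEMAND: at a smooth quiet Euler point `v` of `f`
  (`P[(v·∇)v] = f`) the floor reads `ε₀ ≤ ν[(1 − 2θ₁)‖∇v‖² + (v, ΔΦ₁'(v))]`: the certificate must blow up
  like `1/ν` there (affordable in the unrestricted class, lethal in the Taylor class).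

Companion: `Negative/Uniform.lean` refutes the ν-independent strengthening for every force.
-/

noncomputable section

set_option linter.dupNamespace false

namespace Summit.AnomalousDissipation.AnomalousDissipation.Theses.TaylorCertificates

/-- **Record of the dropped route item `FloorCertificate`** = stmt-AnomalousDissipation-14091 (ledger signature verbatim,
in the route file's namespace; NOT a route item): the route repair rev 13 (2026-08-16) dropped this declaration from the
gate-written Theses file (item closed `moot`), while this append-only `Negative/` module and its importers
(`Negative/Uniform`, `KolmogorovFloorEnsembleCeiling/Negative/SameForce`, the line stubs of crux
`FloorCertificateEnsembleCeiling`, …) still name it ("Unknown identifier" in builds from source since rev 13).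
Re-declared here under its original fully-qualified name and definiens solely so that this negative knowledge keeps
elaborating (convention of `Theorems/TaylorCertificatesTaylorCertificatePairRefutation.lean`); added by the cdisprove
seat of stmt-AnomalousDissipation-14086 (g2), 2026-08-16. -/
def FloorCertificate : Prop :=
  ∃ f : UnitAddTorus (Fin 3) → EuclideanSpace ℝ (Fin 3), Literature.Analysis.FunctionSpaces.Torus.IsSmooth f ∧ Literature.Analysis.FunctionSpaces.Torus.IsDivFree f ∧ Literature.Analysis.FunctionSpaces.Torus.HasZeroMean f ∧ ∃ (ε₀ ν₀ : ℝ), 0 < ε₀ ∧ 0 < ν₀ ∧ ∀ ν : ℝ, 0 < ν → ν < ν₀ → ∃ (Φ₁ : Literature.Analysis.FluidPDE.Torus.CylindricalTest (Fin 3)) (θ₁ : ℝ), θ₁ ≤ 0 ∧ ∀ u : Literature.Analysis.FunctionSpaces.Torus.energySpace (Fin 3), let uf : UnitAddTorus (Fin 3) → EuclideanSpace ℝ (Fin 3) := ((u : MeasureTheory.Lp (EuclideanSpace ℝ (Fin 3)) 2 (MeasureTheory.volume : MeasureTheory.Measure (UnitAddTorus (Fin 3)))) : UnitAddTorus (Fin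 3) → EuclideanSpace ℝ (Fin 3)); let D : ℝ := ν * (Literature.Analysis.FunctionSpaces.Torus.eGradNormSq uf).toReal; let P : ℝ := Literature.Analysis.FluidPDE.Torus.pairing (u : MeasureTheory.Lp (EuclideanSpace ℝ (Fin 3)) 2 (MeasureTheory.volume : MeasureTheory.Measure (UnitAddTorus (Fin 3)))) f - D; Literature.Analysis.FunctionSpaces.Torus.eGradNormSq uf ≠ ⊤ → ‖u‖ ^ 2 ≤ 16 * (∫ x, ‖f x‖ ^ 2) / ν ^ 2 → ε₀ ≤ D + Literature.Analysis.FluidPDE.Torus.nsGeneratorPairing ν f u (Φ₁.grad u) + 2 * θ₁ * P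

end Summit.AnomalousDissipation.AnomalousDissipation.Theses.TaylorCertificates

open MeasureTheory UnitAddTorus Matrix Filter Topology
open scoped InnerProductSpace ENNReal ComplexConjugate

namespace Summit.AnomalousDissipation.AnomalousDissipation.Theorems.FloorCertificate.Negative

open Literature.Analysis.FunctionSpaces Literature.Analysis.FluidPDE
open Summit.AnomalousDissipation.AnomalousDissipation.Theses.TaylorCertificates
open Summit.AnomalousDissipation.AnomalousDissipation.Theorems.TaylorCertificatePair.Negative

/-! ## §A The crux unbundled -/

/-- The FLOOR inequality of the crux at one state `u ∈ H` (verbatim the body of `FloorCertificate`):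
`‖∇u‖ < ∞ → |u|² ≤ 16‖f‖²/ν² → ε₀ ≤ ν‖∇u‖² + ⟨F(u), Φ₁'(u)⟩ + 2θ₁((u,f) − ν‖∇u‖²)`. -/
def FloorIneq (ν : ℝ) (f : (UnitAddTorus (Fin 3) → EuclideanSpace ℝ (Fin 3))) (Φ₁ : Torus.CylindricalTest (Fin 3)) (θ₁ ε₀ : ℝ) (u : (Torus.energySpace (Fin 3))) : Prop :=
  Torus.eGradNormSq ((u : (Lp (EuclideanSpace ℝ (Fin 3)) 2 (volume : Measure (UnitAddTorus (Fin 3))))) : (UnitAddTorus (Fin 3) → EuclideanSpace ℝ (Fin 3))) ≠ ⊤ → ‖u‖ ^ 2 ≤ 16 * (∫ x, ‖f x‖ ^ 2) / ν ^ 2 →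
    ε₀ ≤ ν * (Torus.eGradNormSq ((u : (Lp (EuclideanSpace ℝ (Fin 3)) 2 (volume : Measure (UnitAddTorus (Fin 3))))) : (UnitAddTorus (Fin 3) → EuclideanSpace ℝ (Fin 3)))).toReal + Torus.nsGeneratorPairing ν f u (Φ₁.grad u) +
      2 * θ₁ * (Torus.pairing (u : (Lp (EuclideanSpace ℝ (Fin 3)) 2 (volume : Measure (UnitAddTorus (Fin 3))))) f - ν * (Torus.eGradNormSq ((u : (Lp (EuclideanSpace ℝ (Fin 3)) 2 (volume : Measure (UnitAddTorus (Fin 3))))) : (UnitAddTorus (Fin 3) → EuclideanSpace ℝ (Fin 3)))).toReal)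

/-- A floor family for the force `f` with budget `ε₀` at viscosity `ν`: some cylindrical `Φ₁` and
weight `θ₁ ≤ 0` satisfy the FLOOR inequality at every state of `H`. -/
def FloorFamily (f : (UnitAddTorus (Fin 3) → EuclideanSpace ℝ (Fin 3))) (ε₀ ν : ℝ) : Prop :=
  ∃ (Φ₁ : Torus.CylindricalTest (Fin 3)) (θ₁ : ℝ), θ₁ ≤ 0 ∧ ∀ u : (Torus.energySpace (Fin 3)), FloorIneq ν f Φ₁ θ₁ ε₀ u

/-- `FloorCertificate` says: some smooth solenoidal mean-zero `f` and `ε₀, ν₀ > 0` carry a floor family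
at every `ν ∈ (0, ν₀)` (definitional unbundling). -/
theorem floorCertificate_iff :
    FloorCertificate ↔ ∃ f : (UnitAddTorus (Fin 3) → EuclideanSpace ℝ (Fin 3)), Torus.IsSmooth f ∧ Torus.IsDivFree f ∧ Torus.HasZeroMean f ∧
      ∃ (ε₀ ν₀ : ℝ), 0 < ε₀ ∧ 0 < ν₀ ∧ ∀ ν : ℝ, 0 < ν → ν < ν₀ → FloorFamily f ε₀ ν :=
  Iff.rfl

/-! ## §B Degenerate instances: rest, and the vanishing force -/

/-- **The floor at rest.** `u = 0` is an admissible state (finite enstrophy, inside every ball), and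
there `D = 0`, `P = 0`, `⟨F(0), Φ₁'(0)⟩ = (f, Φ₁'(0))`: a floor family forces the multiplier to PUSH
against the force at rest, `ε₀ ≤ (f, Φ₁'(0))`. (So `Φ₁'(0) ≠ 0`; the certificate is never "flat at
the origin".) -/
theorem floor_at_rest {ν : ℝ} (hν : 0 < ν) {f : (UnitAddTorus (Fin 3) → EuclideanSpace ℝ (Fin 3))} {Φ₁ : Torus.CylindricalTest (Fin 3)} {θ₁ ε₀ : ℝ}
    (h : FloorIneq ν f Φ₁ θ₁ ε₀ 0) : ε₀ ≤ ∫ x, ⟪f x, Φ₁.grad 0 x⟫_ℝ := by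
  have h1 : Torus.eGradNormSq (((0 : (Torus.energySpace (Fin 3))) : (Lp (EuclideanSpace ℝ (Fin 3)) 2 (volume : Measure (UnitAddTorus (Fin 3))))) : (UnitAddTorus (Fin 3) → EuclideanSpace ℝ (Fin 3))) ≠ ⊤ := by
    rw [eGradNormSq_coe_zero]; exact ENNReal.zero_ne_top
  have h2 : ‖(0 : (Torus.energySpace (Fin 3)))‖ ^ 2 ≤ 16 * (∫ x, ‖f x‖ ^ 2) / ν ^ 2 := by
    rw [norm_zero, zero_pow two_ne_zero]
    have : 0 ≤ ∫ x, ‖f x‖ ^ 2 := integral_nonneg fun x => by positivity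
    positivity
  have h3 := h h1 h2
  rw [nsGeneratorPairing_of_ae coe_zero_ae, pairing_of_ae coe_zero_ae, eGradNormSq_coe_zero] at h3
  simpa using h3

/-- **A vanishing force is never a witness**: if `∫‖f‖² = 0` for a smooth `f` then no floor family with
`ε₀ > 0` exists at any `ν > 0` (at rest every term vanishes). -/
theorem floorFamily_force_ne_zero {f : (UnitAddTorus (Fin 3) → EuclideanSpace ℝ (Fin 3))} (hf : Torus.IsSmooth f) {ε₀ ν : ℝ} (hε₀ : 0 < ε₀) (hν : 0 < ν)
    (h : FloorFamily f ε₀ ν) : 0 < ∫ x, ‖f x‖ ^ 2 := by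
  have hF2nn : 0 ≤ ∫ x, ‖f x‖ ^ 2 := integral_nonneg fun x => by positivity
  refine lt_of_le_of_ne hF2nn fun hF0 => ?_
  obtain ⟨Φ₁, θ₁, -, hu⟩ := h
  have hrest := floor_at_rest hν (hu 0)
  have hzero : (∫ x, ⟪f x, Φ₁.grad 0 x⟫_ℝ) = 0 := by
    rw [← integral_zero (α := (UnitAddTorus (Fin 3))) (G := ℝ)]
    refine integral_congr_ae ?_
    filter_upwards [ae_zero_of_integral_sq_zero hf hF0.symm] with x hx
    simp [hx]
  linarith

/-! ## §C Weak duality: a floor family makes every stationary statistical solution LOUD -/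

/-- `‖f‖²_{L²} = ∫ ‖f‖²` for the `L²` class of a square-integrable field. -/
theorem norm_toLp_sq {f : (UnitAddTorus (Fin 3) → EuclideanSpace ℝ (Fin 3))} (hf : MemLp f 2 volume) : ‖hf.toLp f‖ ^ 2 = ∫ x, ‖f x‖ ^ 2 := by
  rw [Torus.norm_toLp_eq_sqrt hf, Real.sq_sqrt (integral_nonneg fun x => by positivity)]

/-- States of the FMRT support ball `|u| ≤ ‖f‖/(4π²ν)` lie in the Leray ball `|u|² ≤ 16‖f‖²/ν²`. -/
theorem ball_of_norm_le {ν : ℝ} (hν : 0 < ν) {f : (UnitAddTorus (Fin 3) → EuclideanSpace ℝ (Fin 3))} (hf : MemLp f 2 volume) {u : (Torus.energySpace (Fin 3))}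
    (hu : ‖u‖ ≤ ‖hf.toLp f‖ / (4 * Real.pi ^ 2 * ν)) : ‖u‖ ^ 2 ≤ 16 * (∫ x, ‖f x‖ ^ 2) / ν ^ 2 := by
  have hπ : 3 ≤ Real.pi := by linarith [Real.pi_gt_three]
  have hF := norm_toLp_sq hf
  have hFnn : 0 ≤ ‖hf.toLp f‖ := norm_nonneg _
  have h1 : ‖u‖ ^ 2 ≤ (‖hf.toLp f‖ / (4 * Real.pi ^ 2 * ν)) ^ 2 := pow_le_pow_left₀ (norm_nonneg _) hu 2
  have h2 : (‖hf.toLp f‖ / (4 * Real.pi ^ 2 * ν)) ^ 2 ≤ 16 * ‖hf.toLp f‖ ^ 2 / ν ^ 2 := by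
    rw [div_pow, mul_pow, div_le_div_iff₀ (by positivity) (by positivity)]
    have h36 : (1 : ℝ) ≤ 4 * Real.pi ^ 2 := by nlinarith [Real.pi_gt_three]
    have hsq : (1 : ℝ) ≤ (4 * Real.pi ^ 2) ^ 2 := one_le_pow₀ h36
    have hc16 : (1 : ℝ) ≤ 16 * (4 * Real.pi ^ 2) ^ 2 := by linarith
    have key : 0 ≤ ‖hf.toLp f‖ ^ 2 * ν ^ 2 * (16 * (4 * Real.pi ^ 2) ^ 2 - 1) :=
      mul_nonneg (mul_nonneg (sq_nonneg _) (sq_nonneg _)) (sub_nonneg.2 hc16)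
    nlinarith [key]
  rw [← hF]; exact h1.trans h2

/-- **Weak duality (the dual reading of the crux, kernel-checked).** If a floor family holds for
`(f, ε₀, ν)` (`ν > 0`, `f ∈ L²`), then EVERY stationary statistical solution `μ` of `NS_ν(f)` (FMRT IV
Def. 1.3, the tree's `IsStationaryStatisticalSolution`) has mean dissipation
`ε(μ) = ν ∫ ‖∇u‖² dμ ≥ ε₀`. Proof: `μ`-a.e. state has finite enstrophy (1.29) and lies in the FMRT
support ball (1.34) ⊂ Leray ball, so the FLOOR holds `μ`-a.e.; integrate: the Liouville equation (1.30)
kills `∫⟨F(u),Φ₁'(u)⟩dμ`, the energy inequality (1.31) gives `∫((u,f) − ν‖∇u‖²)dμ ≥ 0`, and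
`θ₁ ≤ 0` signs the energy channel away. Consequence: `FloorCertificate(f)` ⇒ NO quiet stationary
statistics of `NS_ν(f)` for `ν < ν₀` — steady states, time-average measures, anything. -/
theorem floorFamily_le_ensembleDissipation {ν : ℝ} (hν : 0 < ν) {f : (UnitAddTorus (Fin 3) → EuclideanSpace ℝ (Fin 3))} (hf : MemLp f 2 volume)
    {ε₀ : ℝ} (hfl : FloorFamily f ε₀ ν) {μ : Measure (Torus.energySpace (Fin 3))} (hμ : Torus.IsStationaryStatisticalSolution ν f μ) :
    ε₀ ≤ Torus.ensembleDissipation ν μ := by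
  obtain ⟨Φ₁, θ₁, hθ₁, hfloor⟩ := hfl
  haveI := hμ.prob
  set G : (Torus.energySpace (Fin 3)) → ℝ≥0∞ := fun u => Torus.eGradNormSq ((u : (Lp (EuclideanSpace ℝ (Fin 3)) 2 (volume : Measure (UnitAddTorus (Fin 3))))) : (UnitAddTorus (Fin 3) → EuclideanSpace ℝ (Fin 3))) with hG
  have hGm : Measurable G := Torus.measurable_eGradNormSq_coe
  have hGfin : ∫⁻ u, G u ∂μ < ∞ := hμ.enstrophy_finite
  have hGlt : ∀ᵐ u ∂μ, G u < ∞ := ae_lt_top hGm hGfin.ne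
  have hA : Integrable (fun u => (G u).toReal) μ := hμ.integrable_toReal_eGradNormSq
  have hB : Integrable (fun u : (Torus.energySpace (Fin 3)) => Torus.pairing (u : (Lp (EuclideanSpace ℝ (Fin 3)) 2 (volume : Measure (UnitAddTorus (Fin 3))))) f) μ := hμ.integrable_pairing hf
  obtain ⟨hC, hC0⟩ := hμ.generator Φ₁
  -- the FLOOR holds `μ`-a.e.
  have hae : ∀ᵐ u ∂μ, ε₀ ≤ ν * (G u).toReal + Torus.nsGeneratorPairing ν f u (Φ₁.grad u) +
      2 * θ₁ * (Torus.pairing (u : (Lp (EuclideanSpace ℝ (Fin 3)) 2 (volume : Measure (UnitAddTorus (Fin 3))))) f - ν * (G u).toReal) := by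
    filter_upwards [hGlt, hμ.ae_norm_le hν hf] with u hu hball
    exact hfloor u hu.ne (ball_of_norm_le hν hf hball)
  -- integrate
  have h1 : Integrable (fun u : (Torus.energySpace (Fin 3)) => ν * (G u).toReal) μ := hA.const_mul ν
  have h2 : Integrable (fun u : (Torus.energySpace (Fin 3)) => ν * (G u).toReal + Torus.nsGeneratorPairing ν f u (Φ₁.grad u)) μ := h1.add hC
  have h3 : Integrable (fun u : (Torus.energySpace (Fin 3)) => Torus.pairing (u : (Lp (EuclideanSpace ℝ (Fin 3)) 2 (volume : Measure (UnitAddTorus (Fin 3))))) f - ν * (G u).toReal) μ := hB.sub h1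
  have h4 : Integrable (fun u : (Torus.energySpace (Fin 3)) => 2 * θ₁ * (Torus.pairing (u : (Lp (EuclideanSpace ℝ (Fin 3)) 2 (volume : Measure (UnitAddTorus (Fin 3))))) f - ν * (G u).toReal)) μ := h3.const_mul _
  have hint : Integrable (fun u : (Torus.energySpace (Fin 3)) => ν * (G u).toReal + Torus.nsGeneratorPairing ν f u (Φ₁.grad u) +
      2 * θ₁ * (Torus.pairing (u : (Lp (EuclideanSpace ℝ (Fin 3)) 2 (volume : Measure (UnitAddTorus (Fin 3))))) f - ν * (G u).toReal)) μ := h2.add h4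
  have hmono := integral_mono_ae (integrable_const ε₀) hint hae
  have hconst : ∫ _ : (Torus.energySpace (Fin 3)), ε₀ ∂μ = ε₀ := by simp
  have hsplit : ∫ u : (Torus.energySpace (Fin 3)), (ν * (G u).toReal + Torus.nsGeneratorPairing ν f u (Φ₁.grad u) +
      2 * θ₁ * (Torus.pairing (u : (Lp (EuclideanSpace ℝ (Fin 3)) 2 (volume : Measure (UnitAddTorus (Fin 3))))) f - ν * (G u).toReal)) ∂μ =
      ν * (∫⁻ u, G u ∂μ).toReal + 0 +
        2 * θ₁ * (∫ u : (Torus.energySpace (Fin 3)), Torus.pairing (u : (Lp (EuclideanSpace ℝ (Fin 3)) 2 (volume : Measure (UnitAddTorus (Fin 3))))) f ∂μ - ν * (∫⁻ u, G u ∂μ).toReal) := by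
    rw [integral_add h2 h4, integral_add h1 hC, integral_const_mul, integral_const_mul, integral_sub hB h1,
      integral_const_mul, hC0, integral_toReal hGm.aemeasurable hGlt]
  rw [hconst, hsplit] at hmono
  -- the energy inequality `ν ∫‖∇u‖² ≤ ∫ (u,f)`
  have hE : ν * (Torus.ensembleEnstrophy μ).toReal ≤ ∫ u, Torus.pairing (u : (Lp (EuclideanSpace ℝ (Fin 3)) 2 (volume : Measure (UnitAddTorus (Fin 3))))) f ∂μ :=
    Torus.IsStationaryStatisticalSolution.energy_le_holds hμ hf
  change ν * (∫⁻ u, G u ∂μ).toReal ≤ ∫ u, Torus.pairing (u : (Lp (EuclideanSpace ℝ (Fin 3)) 2 (volume : Measure (UnitAddTorus (Fin 3))))) f ∂μ at hE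
  have hθ : 2 * θ₁ * (∫ u, Torus.pairing (u : (Lp (EuclideanSpace ℝ (Fin 3)) 2 (volume : Measure (UnitAddTorus (Fin 3))))) f ∂μ - ν * (∫⁻ u, G u ∂μ).toReal) ≤ 0 :=
    mul_nonpos_of_nonpos_of_nonneg (by linarith) (by linarith)
  change ε₀ ≤ ν * (∫⁻ u, G u ∂μ).toReal
  linarith

/-- **Every steady state is loud under a floor family** (Dirac case of weak duality, proved directly):
if `u ∈ V` is a steady weak solution of `NS_ν(f)` (`(f,w) + ν(u,Δw) + ∫(u⊗u):∇w = 0` for all `w ∈ 𝒱`),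
then `u` has finite enstrophy, lies in the Leray ball (energy equation `ν‖∇u‖² = (u,f)`, Temam 1979
(1.22), PROVED in tree, plus Poincaré), the generator term vanishes at `u` (`Φ₁'(u) ∈ 𝒱`) and the energy
channel vanishes: the FLOOR at `u` reads `ε₀ ≤ ν‖∇u‖²`, whatever `Φ₁, θ₁`. Hence
`FloorCertificate(f)` forbids QUIET steady states of `NS_ν(f)` uniformly in `ν < ν₀` — the floor half
of `SteadyStatesLoudBounded` is a NECESSARY condition of this crux. -/
theorem floorFamily_le_dissipation_of_steady {ν : ℝ} (hν : 0 < ν) {f : (UnitAddTorus (Fin 3) → EuclideanSpace ℝ (Fin 3))} (hf : MemLp f 2 volume)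
    {ε₀ : ℝ} (hfl : FloorFamily f ε₀ ν) {u : (Torus.energySpace (Fin 3))} (hV : (u : (Lp (EuclideanSpace ℝ (Fin 3)) 2 (volume : Measure (UnitAddTorus (Fin 3))))) ∈ Torus.energySpaceV (Fin 3))
    (hu : Torus.IsSteadyWeakSolution ν f u) :
    ε₀ ≤ ν * (Torus.eGradNormSq ((u : (Lp (EuclideanSpace ℝ (Fin 3)) 2 (volume : Measure (UnitAddTorus (Fin 3))))) : (UnitAddTorus (Fin 3) → EuclideanSpace ℝ (Fin 3)))).toReal := by
  obtain ⟨Φ₁, θ₁, -, hfloor⟩ := hfl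
  have hfin : Torus.eGradNormSq ((u : (Lp (EuclideanSpace ℝ (Fin 3)) 2 (volume : Measure (UnitAddTorus (Fin 3))))) : (UnitAddTorus (Fin 3) → EuclideanSpace ℝ (Fin 3))) ≠ ⊤ := hV.2.eGradNormSq_lt_top.ne
  have henergy : ν * (Torus.eGradNormSq ((u : (Lp (EuclideanSpace ℝ (Fin 3)) 2 (volume : Measure (UnitAddTorus (Fin 3))))) : (UnitAddTorus (Fin 3) → EuclideanSpace ℝ (Fin 3)))).toReal = Torus.pairing (u : (Lp (EuclideanSpace ℝ (Fin 3)) 2 (volume : Measure (UnitAddTorus (Fin 3))))) f :=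
    Torus.IsSteadyWeakSolution.energy_eq' (by simp) hf hV hu
  have hgen : Torus.nsGeneratorPairing ν f u (Φ₁.grad u) = 0 :=
    hu _ (Torus.CylindricalTest.isSmooth_grad_holds Φ₁ u) (Torus.CylindricalTest.isDivFree_grad_holds Φ₁ u)
      (Torus.CylindricalTest.hasZeroMean_grad_holds Φ₁ u)
  -- the Leray ball from the energy equation and Poincaré
  have hball : ‖u‖ ^ 2 ≤ 16 * (∫ x, ‖f x‖ ^ 2) / ν ^ 2 := by
    refine ball_of_norm_le hν hf ?_
    have hP := Torus.norm_sq_le_toReal_eGradNormSq u hfin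
    have hp : Torus.pairing (u : (Lp (EuclideanSpace ℝ (Fin 3)) 2 (volume : Measure (UnitAddTorus (Fin 3))))) f ≤ ‖u‖ * ‖hf.toLp f‖ := (le_abs_self _).trans (Torus.abs_pairing_coe_le hf u)
    rw [le_div_iff₀ (by positivity)]
    by_cases h0 : ‖u‖ = 0
    · rw [h0, zero_mul]; exact norm_nonneg _
    · have hpos : 0 < ‖u‖ := lt_of_le_of_ne (norm_nonneg _) (Ne.symm h0)
      have : ν * (4 * Real.pi ^ 2 * ‖u‖ ^ 2) ≤ ‖u‖ * ‖hf.toLp f‖ := by nlinarith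
      nlinarith
  have h := hfloor u hfin hball
  rw [hgen, ← henergy] at h
  linarith

/-- HYPOTHESIS `QuietStatistics` (OPEN for every genuinely forced case; the inverse-design /
quiet-branch question of the route header): every smooth solenoidal mean-zero force `f ≠ 0` admits, at
arbitrarily small viscosity, a stationary statistical solution of `NS_ν(f)` with mean dissipation below
any prescribed `ε₀ > 0` (hypothesis local to this negative file; an open problem, not a literature fact). -/
def QuietStatistics : Prop :=
  ∀ f : (UnitAddTorus (Fin 3) → EuclideanSpace ℝ (Fin 3)), Torus.IsSmooth f → Torus.IsDivFree f → Torus.HasZeroMean f → 0 < ∫ x, ‖f x‖ ^ 2 →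
    ∀ ε₀ ν₀ : ℝ, 0 < ε₀ → 0 < ν₀ → ∃ ν : ℝ, 0 < ν ∧ ν < ν₀ ∧
      ∃ μ : Measure (Torus.energySpace (Fin 3)), Torus.IsStationaryStatisticalSolution ν f μ ∧ Torus.ensembleDissipation ν μ < ε₀

/-- HYPOTHESIS `QuietSteadyStates` (OPEN; implies `QuietStatistics` through Dirac masses): every smooth
solenoidal mean-zero force `f ≠ 0` has, at arbitrarily small viscosity, a steady weak solution `u ∈ V` of
`NS_ν(f)` with `ν‖∇u‖² < ε₀` (a QUIET steady branch; viscous continuation of forced steady Euler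
states would give one; hypothesis local to this negative file; an open problem, not a literature fact). -/
def QuietSteadyStates : Prop :=
  ∀ f : (UnitAddTorus (Fin 3) → EuclideanSpace ℝ (Fin 3)), Torus.IsSmooth f → Torus.IsDivFree f → Torus.HasZeroMean f → 0 < ∫ x, ‖f x‖ ^ 2 →
    ∀ ε₀ ν₀ : ℝ, 0 < ε₀ → 0 < ν₀ → ∃ ν : ℝ, 0 < ν ∧ ν < ν₀ ∧
      ∃ u : (Torus.energySpace (Fin 3)), (u : (Lp (EuclideanSpace ℝ (Fin 3)) 2 (volume : Measure (UnitAddTorus (Fin 3))))) ∈ Torus.energySpaceV (Fin 3) ∧ Torus.IsSteadyWeakSolution ν f u ∧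
        ν * (Torus.eGradNormSq ((u : (Lp (EuclideanSpace ℝ (Fin 3)) 2 (volume : Measure (UnitAddTorus (Fin 3))))) : (UnitAddTorus (Fin 3) → EuclideanSpace ℝ (Fin 3)))).toReal < ε₀

/-- **Negative lemma modulo `QuietStatistics`**: quiet stationary statistics for every force kill the
crux (weak duality). Not a refutation: `QuietStatistics` is an open problem. -/
theorem floorCertificate_false_of_quietStatistics (hQ : QuietStatistics) : ¬ FloorCertificate := by
  rintro ⟨f, hfs, hdiv, hmean, ε₀, ν₀, hε₀, hν₀, hcert⟩
  have hf2 : MemLp f 2 volume := hfs.memLp 2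
  have hF : 0 < ∫ x, ‖f x‖ ^ 2 :=
    floorFamily_force_ne_zero hfs hε₀ (half_pos hν₀) (hcert (ν₀ / 2) (half_pos hν₀) (by linarith))
  obtain ⟨ν, hν, hνν₀, μ, hμ, hquiet⟩ := hQ f hfs hdiv hmean hF ε₀ ν₀ hε₀ hν₀
  have := floorFamily_le_ensembleDissipation hν hf2 (hcert ν hν hνν₀) hμ
  linarith

/-- **Negative lemma modulo `QuietSteadyStates`**: a quiet steady branch for every force kills the
crux (Dirac case). Not a refutation: `QuietSteadyStates` is an open problem. -/
theorem floorCertificate_false_of_quietSteadyStates (hQ : QuietSteadyStates) : ¬ FloorCertificate := by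
  rintro ⟨f, hfs, hdiv, hmean, ε₀, ν₀, hε₀, hν₀, hcert⟩
  have hf2 : MemLp f 2 volume := hfs.memLp 2
  have hF : 0 < ∫ x, ‖f x‖ ^ 2 :=
    floorFamily_force_ne_zero hfs hε₀ (half_pos hν₀) (hcert (ν₀ / 2) (half_pos hν₀) (by linarith))
  obtain ⟨ν, hν, hνν₀, u, hV, hu, hquiet⟩ := hQ f hfs hdiv hmean hF ε₀ ν₀ hε₀ hν₀
  have := floorFamily_le_dissipation_of_steady hν hf2 (hcert ν hν hνν₀) hV hu
  linarith

/-- **What the crux buys at each viscosity, stated positively for the provers**: under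
`FloorCertificate`, the witness force is nonzero and, for every `ν < ν₀`, Leray's steady states
(which exist at every `ν`, Temam 1979 Thm 1.2, PROVED in tree: `Temam1979_exists_steadyWeakSolution_holds`)
are all `ε₀`-loud. A prover must therefore control the dissipation of EVERY steady state of the chosen
`f` from below, uniformly in `ν` — before any certificate is written. -/
theorem floorCertificate_steady_states_loud (h : FloorCertificate) :
    ∃ f : (UnitAddTorus (Fin 3) → EuclideanSpace ℝ (Fin 3)), Torus.IsSmooth f ∧ 0 < ∫ x, ‖f x‖ ^ 2 ∧ ∃ ε₀ ν₀ : ℝ, 0 < ε₀ ∧ 0 < ν₀ ∧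
      ∀ ν : ℝ, 0 < ν → ν < ν₀ →
        (∃ u : (Torus.energySpace (Fin 3)), (u : (Lp (EuclideanSpace ℝ (Fin 3)) 2 (volume : Measure (UnitAddTorus (Fin 3))))) ∈ Torus.energySpaceV (Fin 3) ∧ Torus.IsSteadyWeakSolution ν f u) ∧
        ∀ u : (Torus.energySpace (Fin 3)), (u : (Lp (EuclideanSpace ℝ (Fin 3)) 2 (volume : Measure (UnitAddTorus (Fin 3))))) ∈ Torus.energySpaceV (Fin 3) → Torus.IsSteadyWeakSolution ν f u →
          ε₀ ≤ ν * (Torus.eGradNormSq ((u : (Lp (EuclideanSpace ℝ (Fin 3)) 2 (volume : Measure (UnitAddTorus (Fin 3))))) : (UnitAddTorus (Fin 3) → EuclideanSpace ℝ (Fin 3)))).toReal := by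
  obtain ⟨f, hfs, hdiv, hmean, ε₀, ν₀, hε₀, hν₀, hcert⟩ := h
  have hf2 : MemLp f 2 volume := hfs.memLp 2
  refine ⟨f, hfs, floorFamily_force_ne_zero hfs hε₀ (half_pos hν₀) (hcert (ν₀ / 2) (half_pos hν₀) (by linarith)),
    ε₀, ν₀, hε₀, hν₀, fun ν hν hνν₀ => ⟨?_, fun u hV hu => ?_⟩⟩
  · exact Torus.Temam1979_exists_steadyWeakSolution_holds (by simp) hν hf2
  · exact floorFamily_le_dissipation_of_steady hν hf2 (hcert ν hν hνν₀) hV hu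

/-! ## §D Coercivity demand at smooth quiet Euler points -/

/-- A smooth solenoidal mean-zero field is (a.e.) the representative of a state of `H`. -/
theorem exists_state_of_smooth {v : (UnitAddTorus (Fin 3) → EuclideanSpace ℝ (Fin 3))} (hv : Torus.IsSmooth v) (hdiv : Torus.IsDivFree v)
    (hmean : Torus.HasZeroMean v) : ∃ u : (Torus.energySpace (Fin 3)), ((u : (Lp (EuclideanSpace ℝ (Fin 3)) 2 (volume : Measure (UnitAddTorus (Fin 3))))) : (UnitAddTorus (Fin 3) → EuclideanSpace ℝ (Fin 3))) =ᵐ[volume] v :=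
  ⟨⟨(hv.memLp 2).toLp v, Torus.smoothSolenoidal_subset_energySpace ⟨v, hv, hdiv, hmean, MemLp.coeFn_toLp _⟩⟩,
    (hv.memLp 2).coeFn_toLp⟩

/-- Smooth fields have finite spectral enstrophy. -/
theorem eGradNormSq_ne_top_of_smooth {v : (UnitAddTorus (Fin 3) → EuclideanSpace ℝ (Fin 3))} (hv : Torus.IsSmooth v) : Torus.eGradNormSq v ≠ ⊤ :=
  (hv.memSobolev_one_complexify.eGradNormSq_lt_top).ne

/-- **The floor at a smooth quiet Euler point (coercivity demand, quantified).** Let `v` be smooth,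
solenoidal, mean-zero and a weak steady solution of the FORCED EULER equations with force `f`,
`∫⟪(v·∇)v − f, w⟫ = 0` for all `w ∈ 𝒱` (a QUIET point: `F_ν(v) = −νAv`; every designer force
`f = P[(v·∇)v]` has one, e.g. Taylor–Green). At the `H`-state `u` of `v`: the inertial term equals
`−((v·∇)v, Φ₁'(u)) = −(f, Φ₁'(u))` (antisymmetry of `b`), so `⟨F_ν(v), Φ₁'(u)⟩ = ν (v, ΔΦ₁'(u))`; and
`(v, f) = ((v·∇)v, v) = 0`, so `P = −ν‖∇v‖²`. The FLOOR at `u` therefore reads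
`ε₀ ≤ ν · [(1 − 2θ₁)‖∇v‖² + (v, ΔΦ₁'(u))]` — the certificate pays at a quiet point ONLY THROUGH `ν`:
`|θ₁| ‖∇v‖²` or the curvature pairing `−(∇v, ∇Φ₁'(u))` must be `≳ ε₀/ν`. In the Taylor class this
1/ν-sized resolved object is what the quiet-point beat harvests (QUIET-POINT-BEAT-r2-6.md); in the
unrestricted class of THIS crux it is affordable (`θ₁ ≤ 0` unbounded, `Φ₁` ν-dependent), which is why
designer forces do not refute `FloorCertificate` by themselves. Any proof must nevertheless exhibit
this 1/ν blow-up of the certificate at every smooth quiet point of its force (or choose an `f` with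
none: crux `SmoothEulerCoerciveForce`). -/
theorem floor_at_quiet_euler_point {ν : ℝ} {f v : (UnitAddTorus (Fin 3) → EuclideanSpace ℝ (Fin 3))} (hf : Torus.IsSmooth f)
    (hv : Torus.IsSmooth v) (hdiv : Torus.IsDivFree v)
    (hquiet : ∀ w : (UnitAddTorus (Fin 3) → EuclideanSpace ℝ (Fin 3)), Torus.IsSmooth w → Torus.IsDivFree w → Torus.HasZeroMean w →
      ∫ x, ⟪Torus.convect v v x - f x, w x⟫_ℝ = 0)
    {Φ₁ : Torus.CylindricalTest (Fin 3)} {θ₁ ε₀ : ℝ}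
    {u : (Torus.energySpace (Fin 3))} (hu : ((u : (Lp (EuclideanSpace ℝ (Fin 3)) 2 (volume : Measure (UnitAddTorus (Fin 3))))) : (UnitAddTorus (Fin 3) → EuclideanSpace ℝ (Fin 3))) =ᵐ[volume] v) (h : FloorIneq ν f Φ₁ θ₁ ε₀ u)
    (hball : ∫ x, ‖v x‖ ^ 2 ≤ 16 * (∫ x, ‖f x‖ ^ 2) / ν ^ 2) :
    ε₀ ≤ ν * ((1 - 2 * θ₁) * (Torus.eGradNormSq v).toReal + ∫ x, ⟪v x, Torus.laplacian (Φ₁.grad u) x⟫_ℝ) := by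
  set W := Φ₁.grad u with hW
  have hWs : Torus.IsSmooth W := Torus.CylindricalTest.isSmooth_grad_holds Φ₁ u
  have hWd : Torus.IsDivFree W := Torus.CylindricalTest.isDivFree_grad_holds Φ₁ u
  have hWm : Torus.HasZeroMean W := Torus.CylindricalTest.hasZeroMean_grad_holds Φ₁ u
  have hmean : Torus.HasZeroMean v := by
    -- `u ∈ H` has zero mean, and `v` is a.e. its representative
    have h0 := Torus.integral_eq_zero_of_mem_energySpace u.2
    unfold Torus.HasZeroMean
    rw [← h0]
    exact integral_congr_ae hu.symm
  have hfin : Torus.eGradNormSq ((u : (Lp (EuclideanSpace ℝ (Fin 3)) 2 (volume : Measure (UnitAddTorus (Fin 3))))) : (UnitAddTorus (Fin 3) → EuclideanSpace ℝ (Fin 3))) ≠ ⊤ := by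
    rw [eGradNormSq_congr_ae' hu]; exact eGradNormSq_ne_top_of_smooth hv
  have hnorm : ‖u‖ ^ 2 ≤ 16 * (∫ x, ‖f x‖ ^ 2) / ν ^ 2 := by rw [norm_sq_of_ae hu]; exact hball
  have hfl := h hfin hnorm
  rw [nsGeneratorPairing_of_ae hu, pairing_of_ae hu, eGradNormSq_congr_ae' hu] at hfl
  -- the inertial term: `∫ ⟪DW v, v⟫ = ∫ ⟪(v·∇)W, v⟫ = -∫ ⟪W, (v·∇)v⟫ = -(f, W)`
  have hI : ∫ x, ⟪Torus.fderiv W x (v x), v x⟫_ℝ = -∫ x, ⟪f x, W x⟫_ℝ := by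
    have h1 : ∫ x, ⟪Torus.convect v W x, v x⟫_ℝ = -∫ x, ⟪W x, Torus.convect v v x⟫_ℝ :=
      Torus.integral_inner_convect_eq_neg hv hdiv hWs hv
    have h2 : ∫ x, ⟪Torus.convect v v x - f x, W x⟫_ℝ = 0 := hquiet W hWs hWd hWm
    have h3 : ∫ x, ⟪Torus.convect v v x - f x, W x⟫_ℝ =
        (∫ x, ⟪W x, Torus.convect v v x⟫_ℝ) - ∫ x, ⟪f x, W x⟫_ℝ := by
      simp_rw [inner_sub_left]
      rw [integral_sub (((hv.convect hv).inner hWs).integrable) ((hf.inner hWs).integrable)]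
      congr 1
      exact integral_congr_ae (ae_of_all _ fun x => real_inner_comm _ _)
    change ∫ x, ⟪Torus.convect v W x, v x⟫_ℝ = _
    rw [h1]
    linarith
  -- the energy channel: `(v, f) = ((v·∇)v, v) = 0`
  have hP : ∫ x, ⟪v x, f x⟫_ℝ = 0 := by
    have h2 : ∫ x, ⟪Torus.convect v v x - f x, v x⟫_ℝ = 0 := hquiet v hv hdiv hmean
    have h3 : ∫ x, ⟪Torus.convect v v x - f x, v x⟫_ℝ =
        (∫ x, ⟪Torus.convect v v x, v x⟫_ℝ) - ∫ x, ⟪v x, f x⟫_ℝ := by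
      simp_rw [inner_sub_left]
      rw [integral_sub (((hv.convect hv).inner hv).integrable) ((hf.inner hv).integrable)]
      congr 1
      exact integral_congr_ae (ae_of_all _ fun x => real_inner_comm _ _)
    rw [h3, Torus.integral_inner_convect_self_eq_zero hv hdiv] at h2
    linarith
  rw [hI, hP] at hfl
  linarith

end Summit.AnomalousDissipation.AnomalousDissipation.Theorems.FloorCertificate.Negative
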